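import Literature.AlgebraicGeometry.HodgeTheory.UniversalHypersurfaceFibreCoordinates
import Literature.AlgebraicGeometry.HodgeTheory.DirectImageIsotopy
import HarnessLib

/-!
# A projective isotopy of the zero sets over a loop computes the rational transport of the universal family
# of smooth hypersurfaces (Voisin I §9.2.1: the local system is trivialised by any `C⁰` trivialisation)

Family `hodge`, layer `Literature/AlgebraicGeometry/HodgeTheory`; proof file (theorems only, no definition, no named
fact). Written by the prover seat `hodge-nonav-prover-Bx` (g13, cell `hodge-nonav`) for crux K1-B
`VeryGeneralSignCommutatorsInHg` of the route `HodgeConjecture/SignSymmetricPowers` (stmt-HodgeConjecture-19716), binder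
`picardLefschetz_nodalForms_uniform` (`HodgeTheory/PicardLefschetzNodalForms`). It is the universal-family twin of
step A5b of the cyclic-cover programme (`CyclicCoverPencilTransport`, prover-Ax): the SOCKET between a geometric
monodromy of a pencil of hypersurfaces — however it is constructed (flows on the regular locus, Ehresmann with boundary
condition, an explicit formula) — and the tree's rational transports `IsRatTransport` of `Rᵏ π_* ℚ` for
`π = family ℂ n d : 𝒴_U → U`, in which the Picard–Lefschetz package `IsPicardLefschetzData` and the localisation sockets
(`PicardLefschetzOfMonodromyHomeomorphism.exists_isPicardLefschetzData_one_of_homotopyConj_antipodal`, whose hypotheses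
`hT : IsRatTransport … (loopClassUniv n d γ) T`, `hTh : T = h^*` are exactly the output below) are typed.

**`exists_homeomorph_isRatTransport_of_isotopy`** — let `γ` be a loop at `s ∈ U(ℂ)` and `h_u, k_u` (`u ∈ [0, 1]`)
self-maps of `ℙ(ℂⁿ⁺²)` with `h_u{F_s = 0} ⊆ {F_{γ u} = 0}`, `k_u{F_{γ u} = 0} ⊆ {F_s = 0}`, inverse to each other
there, `h_0 = id` on `{F_s = 0}`, and `(u, [z]) ↦ h_u[z]` jointly continuous on `[0,1] × {F_s = 0}`. Then there is a
homeomorphism `η` of `Y_s(ℂ)` reading `h_1` (and `η⁻¹` reading `k_1`) such that, in EVERY degree `k'`, `(η⁻¹)^*` is the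
rational transport along `γ`: `IsRatTransport (family ℂ n d) k' hU (loopClassUniv n d γ) (η⁻¹)^*` ("the monodromy of
a trivialised family is the holonomy of the trivialisation", `DirectImageIsotopy.transportFun_eq_of_isotopy`; the
continuity of the inverse maps is automatic, the fibres being compact Hausdorff —
`UniversalHypersurfaceFibreCoordinates`).

## References

* [VoisinHodgeI2002] C. Voisin, Hodge Theory and Complex Algebraic Geometry I, CUP 2002, §9.2.1 and Prop. 9.5.
* [VoisinHodgeII2003] C. Voisin, Hodge Theory and Complex Algebraic Geometry II, CUP 2003, §3.1.2 (the monodromy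
  representation), §3.2.1 (the loop around a critical value), §6.2.1 (the universal hypersurface).
* [ArnoldGuseinzadeVarchenko2012] V. I. Arnold, S. M. Gusein-Zade, A. N. Varchenko, Singularities of Differentiable
  Maps II (2012 reprint), Part I §1.1 (the monodromy transformation of a trivialised fibration).
-/

noncomputable section

open CategoryTheory AlgebraicGeometry
open _root_.Topology
open scoped unitInterval LinearAlgebra.Projectivization
open Literature.AlgebraicTopology.SingularHomology
open Literature.AlgebraicGeometry.Motives Literature.AlgebraicGeometry.Motives.UniversalHypersurface
open Literature.AlgebraicGeometry.HodgeTheory.UniversalHypersurface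

namespace Literature.AlgebraicGeometry.HodgeTheory

section HodgeTheory

/-! ### §3 Transport along a loop covered by a projective isotopy of the zero sets -/

section Transport

variable {n d : ℕ}

/-- **A projective isotopy of the zero sets over a loop computes the rational transport** ("the monodromy of a
trivialised family is the holonomy of the trivialisation"). Data: `n, d ≥ 1`, a cohomological trivialisation datum
`hU` of `π = family ℂ n d`, a loop `γ` at `s ∈ U(ℂ)`, and self-maps `h u`, `k u` of `ℙ(ℂⁿ⁺²)` (`u ∈ [0, 1]`) with
`h u {F_s = 0} ⊆ {F_{γ u} = 0}`, `k u {F_{γ u} = 0} ⊆ {F_s = 0}`, `k u ∘ h u = id` on `{F_s = 0}`, `h u ∘ k u = id` on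
`{F_{γ u} = 0}`, `h 0 = id` on `{F_s = 0}`, and `(u, [z]) ↦ h u [z]` continuous on `[0, 1] × {F_s = 0}`. Conclusion:
a homeomorphism `η` of `Y_s(ℂ)` with `[η y] = h 1 [y]`, `[η⁻¹ y] = k 1 [y]`, such that in every degree `k'` the map
`(η⁻¹)^* = Hᵏ'(η.symm)` on `Hᵏ'(Y_s(ℂ); ℚ)` is the rational transport of `Rᵏ' π_* ℚ` along `γ` (the last clause records
that this linear equivalence is `v ↦ (η⁻¹)^* v` on the nose). The continuity of the `k u` and of `η⁻¹` is automatic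
(compact Hausdorff fibres). [cite: VoisinHodgeI2002, §9.2.1 and Prop. 9.5] [cite: VoisinHodgeII2003, §3.1.2 and §6.2.1]
[cite: ArnoldGuseinzadeVarchenko2012, Part I §1.1] -/
theorem exists_homeomorph_isRatTransport_of_isotopy (hn : 1 ≤ n) (hd : 1 ≤ d)
    (hU : IsCohomologicallyLocallyTrivialOn (family ℂ n d) Set.univ)
    {s : ComplexPoints (base ℂ n d)} (γ : Path s s)
    (h k : I → ℙ ℂ (Fin (n + 2) → ℂ) → ℙ ℂ (Fin (n + 2) → ℂ))
    (hhc : Continuous fun uy : I × {ℓ // ℓ ∈ Projectivization.projZeroLocus {pointForm ℂ n d s}} =>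
      h uy.1 uy.2.1)
    (hh0 : ∀ ℓ ∈ Projectivization.projZeroLocus {pointForm ℂ n d s}, h 0 ℓ = ℓ)
    (hhm : ∀ u : I, ∀ ℓ ∈ Projectivization.projZeroLocus {pointForm ℂ n d s},
      h u ℓ ∈ Projectivization.projZeroLocus {pointForm ℂ n d (γ u)})
    (hkm : ∀ u : I, ∀ ℓ ∈ Projectivization.projZeroLocus {pointForm ℂ n d (γ u)},
      k u ℓ ∈ Projectivization.projZeroLocus {pointForm ℂ n d s})
    (hkh : ∀ u : I, ∀ ℓ ∈ Projectivization.projZeroLocus {pointForm ℂ n d s}, k u (h u ℓ) = ℓ)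
    (hhk : ∀ u : I, ∀ ℓ ∈ Projectivization.projZeroLocus {pointForm ℂ n d (γ u)}, h u (k u ℓ) = ℓ) :
    ∃ η : ComplexPoints (fiberOver (family ℂ n d) s) ≃ₜ ComplexPoints (fiberOver (family ℂ n d) s),
      (∀ y, fibrePoint n d s (η y) = h 1 (fibrePoint n d s y)) ∧
      (∀ y, fibrePoint n d s (η.symm y) = k 1 (fibrePoint n d s y)) ∧
      (∀ k' : ℕ, IsRatTransport (family ℂ n d) k' hU (loopClassUniv n d γ)
        (singularCohomology.mapIso ℚ ℚ η.symm k').toLinearEquiv) ∧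
      ∀ (k' : ℕ) (v : bettiCohomology (fiberOver (family ℂ n d) s) k'),
        (singularCohomology.mapIso ℚ ℚ η.symm k').toLinearEquiv v =
          (singularCohomology.map ℚ ℚ (η.symm : C(ComplexPoints (fiberOver (family ℂ n d) s),
            ComplexPoints (fiberOver (family ℂ n d) s))) k').hom v := by
  classical
  -- the fibres as the zero sets
  choose e he using fun t : ComplexPoints (base ℂ n d) => exists_homeomorph_fibrePoint (n := n) hd t
  have he_symm : ∀ (t : ComplexPoints (base ℂ n d))
      (q : {ℓ // ℓ ∈ Projectivization.projZeroLocus {pointForm ℂ n d t}}),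
      fibrePoint n d t ((e t).symm q) = q.1 := by
    intro t q
    rw [← he t, Homeomorph.apply_symm_apply]
  -- the fibre maps read through the coordinates, for a target base point `t` and the four set-level hypotheses
  let fwd : ∀ (u : I) (t : ComplexPoints (base ℂ n d)),
      (∀ ℓ ∈ Projectivization.projZeroLocus {pointForm ℂ n d s},
        h u ℓ ∈ Projectivization.projZeroLocus {pointForm ℂ n d t}) →
      ComplexPoints (fiberOver (family ℂ n d) s) → ComplexPoints (fiberOver (family ℂ n d) t) :=
    fun u t H1 y => (e t).symm ⟨h u (fibrePoint n d s y), H1 _ (fibrePoint_mem_projZeroLocus hd s y)⟩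
  let bwd : ∀ (u : I) (t : ComplexPoints (base ℂ n d)),
      (∀ ℓ ∈ Projectivization.projZeroLocus {pointForm ℂ n d t},
        k u ℓ ∈ Projectivization.projZeroLocus {pointForm ℂ n d s}) →
      ComplexPoints (fiberOver (family ℂ n d) t) → ComplexPoints (fiberOver (family ℂ n d) s) :=
    fun u t H2 y => (e s).symm ⟨k u (fibrePoint n d t y), H2 _ (fibrePoint_mem_projZeroLocus hd t y)⟩
  have hfwd_val : ∀ u t H1 y, fibrePoint n d t (fwd u t H1 y) = h u (fibrePoint n d s y) :=
    fun u t H1 y => he_symm t _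
  have hbwd_val : ∀ u t H2 y, fibrePoint n d s (bwd u t H2 y) = k u (fibrePoint n d t y) :=
    fun u t H2 y => he_symm s _
  have hleft : ∀ u t H1 H2
      (H3 : ∀ ℓ ∈ Projectivization.projZeroLocus {pointForm ℂ n d s}, k u (h u ℓ) = ℓ) y,
      bwd u t H2 (fwd u t H1 y) = y := by
    intro u t H1 H2 H3 y
    apply fibrePoint_injective s
    rw [hbwd_val u t H2 (fwd u t H1 y), hfwd_val u t H1 y, H3 _ (fibrePoint_mem_projZeroLocus hd s y)]
  have hright : ∀ u t H1 H2
      (H4 : ∀ ℓ ∈ Projectivization.projZeroLocus {pointForm ℂ n d t}, h u (k u ℓ) = ℓ) y,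
      fwd u t H1 (bwd u t H2 y) = y := by
    intro u t H1 H2 H4 y
    apply fibrePoint_injective t
    rw [hfwd_val u t H1 (bwd u t H2 y), hbwd_val u t H2 y, H4 _ (fibrePoint_mem_projZeroLocus hd t y)]
  have hfwd_cont : ∀ u t H1, Continuous (fwd u t H1) := by
    intro u t H1
    refine (e t).symm.continuous.comp (Continuous.subtype_mk ?_ _)
    have hin : Continuous fun y : ComplexPoints (fiberOver (family ℂ n d) s) =>
        ((u, ⟨fibrePoint n d s y, fibrePoint_mem_projZeroLocus hd s y⟩) :
          I × {ℓ // ℓ ∈ Projectivization.projZeroLocus {pointForm ℂ n d s}}) :=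
      continuous_const.prodMk ((continuous_fibrePoint s).subtype_mk _)
    exact hhc.comp hin
  -- topology of the fibres
  haveI hcpt : CompactSpace (ComplexPoints (fiberOver (family ℂ n d) s)) := compactSpace_fibre_family hn hd s
  have hT2t : ∀ t : ComplexPoints (base ℂ n d), T2Space (ComplexPoints (fiberOver (family ℂ n d) t)) :=
    fun t => t2Space_fibre_family t
  -- the fibre homeomorphisms (continuous bijections from a compact space to a Hausdorff space)
  let Hom : ∀ (u : I) (t : ComplexPoints (base ℂ n d))
      (H1 : ∀ ℓ ∈ Projectivization.projZeroLocus {pointForm ℂ n d s},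
        h u ℓ ∈ Projectivization.projZeroLocus {pointForm ℂ n d t})
      (H2 : ∀ ℓ ∈ Projectivization.projZeroLocus {pointForm ℂ n d t},
        k u ℓ ∈ Projectivization.projZeroLocus {pointForm ℂ n d s})
      (_H3 : ∀ ℓ ∈ Projectivization.projZeroLocus {pointForm ℂ n d s}, k u (h u ℓ) = ℓ)
      (_H4 : ∀ ℓ ∈ Projectivization.projZeroLocus {pointForm ℂ n d t}, h u (k u ℓ) = ℓ),
      ComplexPoints (fiberOver (family ℂ n d) s) ≃ₜ ComplexPoints (fiberOver (family ℂ n d) t) :=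
    fun u t H1 H2 H3 H4 =>
      haveI := hT2t t
      Continuous.homeoOfEquivCompactToT2
        (f := { toFun := fwd u t H1, invFun := bwd u t H2, left_inv := hleft u t H1 H2 H3,
                right_inv := hright u t H1 H2 H4 })
        (hfwd_cont u t H1)
  have hHom_apply : ∀ u t H1 H2 H3 H4 y, Hom u t H1 H2 H3 H4 y = fwd u t H1 y :=
    fun _ _ _ _ _ _ _ => rfl
  have hHom_symm_apply : ∀ u t H1 H2 H3 H4 y, (Hom u t H1 H2 H3 H4).symm y = bwd u t H2 y :=
    fun _ _ _ _ _ _ _ => rfl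
  -- the hypotheses at the endpoints `γ 0 = s`, `γ 1 = s`
  have H1z : ∀ ℓ ∈ Projectivization.projZeroLocus {pointForm ℂ n d s},
      h 0 ℓ ∈ Projectivization.projZeroLocus {pointForm ℂ n d s} := fun ℓ hℓ => by
    have h' := hhm 0 ℓ hℓ
    rwa [γ.source] at h'
  have H1e : ∀ ℓ ∈ Projectivization.projZeroLocus {pointForm ℂ n d s},
      h 1 ℓ ∈ Projectivization.projZeroLocus {pointForm ℂ n d s} := fun ℓ hℓ => by
    have h' := hhm 1 ℓ hℓ
    rwa [γ.target] at h'
  have H2e : ∀ ℓ ∈ Projectivization.projZeroLocus {pointForm ℂ n d s},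
      k 1 ℓ ∈ Projectivization.projZeroLocus {pointForm ℂ n d s} := fun ℓ hℓ =>
    hkm 1 ℓ (by rw [γ.target]; exact hℓ)
  have H4e : ∀ ℓ ∈ Projectivization.projZeroLocus {pointForm ℂ n d s}, h 1 (k 1 ℓ) = ℓ := fun ℓ hℓ =>
    hhk 1 ℓ (by rw [γ.target]; exact hℓ)
  -- the time-one homeomorphism
  let η : ComplexPoints (fiberOver (family ℂ n d) s) ≃ₜ ComplexPoints (fiberOver (family ℂ n d) s) :=
    Hom 1 s H1e H2e (hkh 1) H4e
  have hT : ∀ (k' : ℕ) (v : bettiCohomology (fiberOver (family ℂ n d) s) k'),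
      (singularCohomology.mapIso ℚ ℚ η.symm k').toLinearEquiv v =
        (singularCohomology.map ℚ ℚ (η.symm : C(ComplexPoints (fiberOver (family ℂ n d) s),
          ComplexPoints (fiberOver (family ℂ n d) s))) k').hom v := fun _ _ => rfl
  refine ⟨η, fun y => ?_, fun y => ?_, fun k' => ?_, hT⟩
  · change fibrePoint n d s (Hom 1 s H1e H2e (hkh 1) H4e y) = _
    rw [hHom_apply 1 s H1e H2e (hkh 1) H4e y, hfwd_val 1 s H1e y]
  · change fibrePoint n d s ((Hom 1 s H1e H2e (hkh 1) H4e).symm y) = _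
    rw [hHom_symm_apply 1 s H1e H2e (hkh 1) H4e y, hbwd_val 1 s H2e y]
  -- the loop in `Set.univ ⊆ U(ℂ)` and the isotopy over it
  let γ' : Path (toUniv n d s) (toUniv n d s) := γ.map (toUniv n d).continuous
  have hhm' : ∀ u : I, ∀ ℓ ∈ Projectivization.projZeroLocus {pointForm ℂ n d s},
      h u ℓ ∈ Projectivization.projZeroLocus {pointForm ℂ n d (γ' u).1} := hhm
  have hkm' : ∀ u : I, ∀ ℓ ∈ Projectivization.projZeroLocus {pointForm ℂ n d (γ' u).1},
      k u ℓ ∈ Projectivization.projZeroLocus {pointForm ℂ n d s} := hkm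
  have hhk' : ∀ u : I, ∀ ℓ ∈ Projectivization.projZeroLocus {pointForm ℂ n d (γ' u).1},
      h u (k u ℓ) = ℓ := hhk
  let hfam : ∀ u : I, C(ComplexPoints (fiberOver (family ℂ n d) s),
      ComplexPoints (fiberOver (family ℂ n d) (γ' u).1)) :=
    fun u => (Hom u (γ' u).1 (hhm' u) (hkm' u) (hkh u) (hhk' u) :
      C(ComplexPoints (fiberOver (family ℂ n d) s), ComplexPoints (fiberOver (family ℂ n d) (γ' u).1)))
  -- coordinates and base point of the moved points
  have hcoords : ∀ u t H1 H2 H3 H4 (y : ComplexPoints (fiberOver (family ℂ n d) s)),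
      (hypersurfacePoint (toProjectiveSpace ℂ n d)
          (AlgPoints.map (fiberι (family ℂ n d) t) (Hom u t H1 H2 H3 H4 y)),
        AlgPoints.map (family ℂ n d) (AlgPoints.map (fiberι (family ℂ n d) t) (Hom u t H1 H2 H3 H4 y))) =
      (h u (fibrePoint n d s y), t) := by
    intro u t H1 H2 H3 H4 y
    rw [AlgPoints.map_map_fiberι, ← fibrePoint_eq_hypersurfacePoint_map_fiberι, hHom_apply u t H1 H2 H3 H4 y,
      hfwd_val u t H1 y]
  -- joint continuity inside `𝒴_U(ℂ)`
  have hcont : Continuous fun yu : ComplexPoints (fiberOver (family ℂ n d) s) × I =>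
      AlgPoints.map (fiberι (family ℂ n d) (γ' yu.2).1) (hfam yu.2 yu.1) := by
    rw [(isClosedEmbedding_coords_prod_map_family n d hn hd).isEmbedding.isInducing.continuous_iff]
    have heq : ((fun P : ComplexPoints (total ℂ n d) =>
        (hypersurfacePoint (toProjectiveSpace ℂ n d) P, AlgPoints.map (family ℂ n d) P)) ∘
        fun yu : ComplexPoints (fiberOver (family ℂ n d) s) × I =>
          AlgPoints.map (fiberι (family ℂ n d) (γ' yu.2).1) (hfam yu.2 yu.1)) =
        fun yu => (h yu.2 (fibrePoint n d s yu.1), (γ' yu.2).1) := by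
      funext yu
      exact hcoords yu.2 (γ' yu.2).1 (hhm' yu.2) (hkm' yu.2) (hkh yu.2) (hhk' yu.2) yu.1
    rw [heq]
    have hin : Continuous fun yu : ComplexPoints (fiberOver (family ℂ n d) s) × I =>
        ((yu.2, ⟨fibrePoint n d s yu.1, fibrePoint_mem_projZeroLocus hd s yu.1⟩) :
          I × {ℓ // ℓ ∈ Projectivization.projZeroLocus {pointForm ℂ n d s}}) :=
      continuous_snd.prodMk (((continuous_fibrePoint s).comp continuous_fst).subtype_mk _)
    exact (hhc.comp hin).prodMk (continuous_subtype_val.comp (γ'.continuous.comp continuous_snd))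
  -- injectivity of `h_u^*` (a homeomorphism) and the transported classes
  have hinj : ∀ u : I, Function.Injective (singularCohomology.map ℂ ℂ (hfam u) k') := fun u =>
    (singularCohomology.mapIso ℂ ℂ (Hom u (γ' u).1 (hhm' u) (hkm' u) (hkh u) (hhk' u)) k').toLinearEquiv.injective
  have hcomp : ∀ u t H1 H2 H3 H4,
      ((Hom u t H1 H2 H3 H4).symm : C(ComplexPoints (fiberOver (family ℂ n d) t),
          ComplexPoints (fiberOver (family ℂ n d) s))).comp
        (Hom u t H1 H2 H3 H4 : C(ComplexPoints (fiberOver (family ℂ n d) s),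
          ComplexPoints (fiberOver (family ℂ n d) t))) =
      ContinuousMap.id (ComplexPoints (fiberOver (family ℂ n d) s)) := fun u t H1 H2 H3 H4 =>
    ContinuousMap.ext fun y => (Hom u t H1 H2 H3 H4).symm_apply_apply y
  have hcancel : ∀ u t H1 H2 H3 H4 (a : singularCohomology ℂ ℂ (ComplexPoints (fiberOver (family ℂ n d) s)) k'),
      singularCohomology.map ℂ ℂ (Hom u t H1 H2 H3 H4 : C(ComplexPoints (fiberOver (family ℂ n d) s),
          ComplexPoints (fiberOver (family ℂ n d) t))) k'
        (singularCohomology.map ℂ ℂ ((Hom u t H1 H2 H3 H4).symm : C(ComplexPoints (fiberOver (family ℂ n d) t),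
          ComplexPoints (fiberOver (family ℂ n d) s))) k' a) = a := by
    intro u t H1 H2 H3 H4 a
    rw [← ModuleCat.comp_apply, ← singularCohomology.map_comp, hcomp u t H1 H2 H3 H4, singularCohomology.map_id]
    rfl
  -- the endpoint identifications, stated for a variable base point so that `γ 0 = s`, `γ 1 = s` can be substituted
  have hstart : ∀ (t : ComplexPoints (base ℂ n d)) H1 H2 H3 H4
      (a : singularCohomology ℂ ℂ (ComplexPoints (fiberOver (family ℂ n d) s)) k'), s = t →
      (⟨t, singularCohomology.map ℂ ℂ ((Hom 0 t H1 H2 H3 H4).symm :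
          C(ComplexPoints (fiberOver (family ℂ n d) t), ComplexPoints (fiberOver (family ℂ n d) s))) k' a⟩ :
        FiberClass (family ℂ n d) k') = ⟨s, a⟩ := by
    rintro t H1 H2 H3 H4 a rfl
    have hid : ((Hom 0 s H1 H2 H3 H4).symm :
        C(ComplexPoints (fiberOver (family ℂ n d) s), ComplexPoints (fiberOver (family ℂ n d) s))) =
        ContinuousMap.id (ComplexPoints (fiberOver (family ℂ n d) s)) := by
      refine ContinuousMap.ext fun y => ?_
      rw [ContinuousMap.id_apply, ContinuousMap.coe_coe, hHom_symm_apply 0 s H1 H2 H3 H4 y]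
      have hfix : fwd 0 s H1 y = y :=
        fibrePoint_injective s (by rw [hfwd_val 0 s H1 y, hh0 _ (fibrePoint_mem_projZeroLocus hd s y)])
      calc bwd 0 s H2 y = bwd 0 s H2 (fwd 0 s H1 y) := by rw [hfix]
        _ = y := hleft 0 s H1 H2 H3 y
    rw [hid, singularCohomology.map_id]
    rfl
  have hend : ∀ (t : ComplexPoints (base ℂ n d)) H1 H2 H3 H4
      (a : singularCohomology ℂ ℂ (ComplexPoints (fiberOver (family ℂ n d) s)) k'), s = t →
      (⟨t, singularCohomology.map ℂ ℂ ((Hom 1 t H1 H2 H3 H4).symm :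
          C(ComplexPoints (fiberOver (family ℂ n d) t), ComplexPoints (fiberOver (family ℂ n d) s))) k' a⟩ :
        FiberClass (family ℂ n d) k') =
        ⟨s, singularCohomology.map ℂ ℂ (η.symm :
          C(ComplexPoints (fiberOver (family ℂ n d) s), ComplexPoints (fiberOver (family ℂ n d) s))) k' a⟩ := by
    rintro t H1 H2 H3 H4 a rfl
    rfl
  -- the transport of `v ⊗ 1` along `γ` is `(η⁻¹)^* (v ⊗ 1)`
  intro v
  set a : singularCohomology ℂ ℂ (ComplexPoints (fiberOver (family ℂ n d) s)) k' := ofRatClass _ k' v with ha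
  let c : ∀ u : I, complexBetti (fiberOver (family ℂ n d) (γ' u).1) k' := fun u =>
    singularCohomology.map ℂ ℂ ((Hom u (γ' u).1 (hhm' u) (hkm' u) (hkh u) (hhk' u)).symm :
      C(ComplexPoints (fiberOver (family ℂ n d) (γ' u).1), ComplexPoints (fiberOver (family ℂ n d) s))) k' a
  have hc : ∀ u, singularCohomology.map ℂ ℂ (hfam u) k' (c u) = a := fun u =>
    hcancel u (γ' u).1 (hhm' u) (hkm' u) (hkh u) (hhk' u) a
  have h0 : (⟨(γ' 0).1, c 0⟩ : FiberClass (family ℂ n d) k') = ⟨s, a⟩ :=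
    hstart (γ' 0).1 (hhm' 0) (hkm' 0) (hkh 0) (hhk' 0) a γ.source.symm
  have h1 : (⟨(γ' 1).1, c 1⟩ : FiberClass (family ℂ n d) k') =
      ⟨s, singularCohomology.map ℂ ℂ (η.symm :
        C(ComplexPoints (fiberOver (family ℂ n d) s), ComplexPoints (fiberOver (family ℂ n d) s))) k' a⟩ :=
    hend (γ' 1).1 (hhm' 1) (hkm' 1) (hkh 1) (hhk' 1) a γ.target.symm
  have htr := transportFun_eq_of_isotopy (family ℂ n d) k' hU γ' hfam hcont hinj c a hc h0 h1
  -- rationality: `((η⁻¹)^* v) ⊗ 1 = (η⁻¹)^* (v ⊗ 1)`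
  change ofRatClass (ComplexPoints (fiberOver (family ℂ n d) s)) k'
      ((singularCohomology.map ℚ ℚ (η.symm : C(ComplexPoints (fiberOver (family ℂ n d) s),
        ComplexPoints (fiberOver (family ℂ n d) s))) k').hom v) =
    transportFun (family ℂ n d) k' hU ⟦γ'⟧ a
  rw [htr, ha]
  exact ofRatClass_map _ _ v

end Transport

end HodgeTheory

end Literature.AlgebraicGeometry.HodgeTheory

end
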